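import Literature.Analysis.Asymptotics.LaplaceMethodMultivariate
import HarnessLib

/-!
# Route `SwapVirialDeficit` (YangMills): the ANISOTROPIC (diagonal) GAUSSIAN CEILING of a quadratic-form integral on `EuclideanSpace ℝ ι` —
# `∫ e^{−Q/2} ≤ Π_i √(2π/κ_i)` when `Σ_i κ_i y_i² ≤ Q(y)` (the generic half of the anisotropic one-loop bound for stub S4(i): finiteness of the Morse–Bott
# main constant needs the SOFT modes counted with their own stiffnesses, not the isotropic `λ^{−m/2}`)

Width seat ym-line-sfw-p2-w2 g59 (cell ym-idea-1, free hands; `--supports stmt-QuantumFields-24197`; generic, model-free).  w3 g66's S4 analysis (STATUS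
2026-08-31T18:01Z, endorsed by LEAD 18:02Z): even `0 < 𝔐₀ < ∞` is not available from isotropic coercivity (`λ^{−α} ∼ sin^{−18L⁴}ψ` is not integrable over the hub),
it needs the anisotropic floor `Q ≥ κ_x|u|² + κ_y|v|² + κ_z|z|² + κ_F Σ|η_f|²` (only `2 + 2` soft directions) and then `𝔪 ≤ ρ(η₀)·κ_x⁻¹κ_y⁻¹κ_z^{−3/2}κ_F^{−3|Fol L|/2}`.
This file is the generic inequality behind the second step, for an arbitrary coordinatewise weight `κ : ι → ℝ_{>0}` on `EuclideanSpace ℝ ι` (so block-constant weights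
on ✓`GnoFibre L = EuclideanSpace ℝ ((Fin 2 ⊕ Fin 2) ⊕ (Fin 3 ⊕ Fol L × Fin 3))` are covered):

* ★ `integral_exp_neg_half_diag` — `∫ exp(−½ Σ_i κ_i y_i²) dy = Π_i (2π/κ_i)^{1/2}` (✓`PiLp.volume_preserving_toLp`, Fubini ✓`integral_fintype_prod_volume_eq_prod`,
  lit ✓`integral_exp_neg_half_mul_sq`);
* `integrable_exp_neg_half_of_diag_le` — `Σ κ_i y_i² ≤ Q`, `0 < λ ≤ κ_i` ⟹ `e^{−Q/2}` integrable;
* ★★ `integral_exp_neg_half_le_of_diag` — `∫ e^{−Q/2} ≤ Π_i (2π/κ_i)^{1/2}`;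
* ★ `normalised_integral_exp_neg_half_le_of_diag` — `(2π)^{−|ι|/2}·∫ e^{−Q/2} ≤ Π_i κ_i^{−1/2}` (the shape of a Morse–Bott density `ρ·(2π)^{−α}∫e^{−Q/2}`).

HONEST LABEL: elementary (theorems only, 0 `def`, 0 `sorry`, standard axioms); the model half (the anisotropic ray coercivity at every hub, w3 g66's lane, and the
cone integrability of `κ_x⁻¹κ_y⁻¹`) is NOT here.  ⟨24197⟩ ∕ ⟨24194⟩ OPEN; own crux ⟨22884⟩ OPEN (blocked-on ⟨19935⟩); the Yang–Mills mass gap is NOT proved; no summit is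
proved by a line.  References: [cite: Breitung1994, Lemma 26 (2.102), p. 30]; [cite: Breitung1994, Lemma 39 p. 55]; [folklore].
-/

set_option autoImplicit false

noncomputable section

open _root_.MeasureTheory _root_.Set _root_.Module
open scoped _root_.Real _root_.InnerProductSpace _root_.BigOperators

namespace Summit.QuantumFields.YangMills.Theorems.QuantitativeLaplace

variable {ι : Type*} [Fintype ι]

/-- ★ **The diagonal anisotropic Gaussian integral**: `∫_{ℝ^ι} exp(−½ Σ_i κ_i y_i²) dy = Π_i (2π/κ_i)^{1/2}` (`κ_i > 0`; volume of `EuclideanSpace ℝ ι`).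
[cite: Breitung1994, Lemma 26 (2.102), p. 30] -/
theorem integral_exp_neg_half_diag (κ : ι → ℝ) (hκ : ∀ i, 0 < κ i) :
    ∫ y : EuclideanSpace ℝ ι, Real.exp (-(1 / 2) * ∑ i, κ i * (y i) ^ 2) = ∏ i, (2 * π / κ i) ^ (1 / 2 : ℝ) := by
  rw [← (PiLp.volume_preserving_toLp ι).integral_comp (MeasurableEquiv.toLp 2 _).measurableEmbedding]
  have hfun : (fun w : ι → ℝ => Real.exp (-(1 / 2) * ∑ i, κ i * ((WithLp.toLp 2 w : EuclideanSpace ℝ ι) i) ^ 2)) =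
      fun w => ∏ i, Real.exp (-(1 / 2) * (κ i * (w i) ^ 2)) := by
    funext w
    rw [← Real.exp_sum, Finset.mul_sum]
  rw [hfun, integral_fintype_prod_volume_eq_prod (fun i t => Real.exp (-(1 / 2) * (κ i * t ^ 2)))]
  exact Finset.prod_congr rfl fun i _ => Literature.Analysis.Asymptotics.integral_exp_neg_half_mul_sq (hκ i)

/-- The diagonal form dominates `λ‖y‖²` when `λ ≤ κ_i` for all `i`. [folklore] -/
theorem mul_norm_sq_le_diag {κ : ι → ℝ} {lam : ℝ} (hκlam : ∀ i, lam ≤ κ i) (y : EuclideanSpace ℝ ι) :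
    lam * ‖y‖ ^ 2 ≤ ∑ i, κ i * (y i) ^ 2 := by
  rw [EuclideanSpace.real_norm_sq_eq, Finset.mul_sum]
  exact Finset.sum_le_sum fun i _ => mul_le_mul_of_nonneg_right (hκlam i) (sq_nonneg _)

/-- A measurable `Q` with `Σ κ_i y_i² ≤ Q(y)`, `0 < λ ≤ κ_i`, has `e^{−Q/2}` integrable (domination by the round Gaussian of rate `λ/2`). [cite: Breitung1994, Lemma 39 p. 55] -/
theorem integrable_exp_neg_half_of_diag_le {Q : EuclideanSpace ℝ ι → ℝ} (hQm : Measurable Q) {κ : ι → ℝ} {lam : ℝ} (hlam : 0 < lam)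
    (hκlam : ∀ i, lam ≤ κ i) (hQ : ∀ y, ∑ i, κ i * (y i) ^ 2 ≤ Q y) :
    Integrable (fun y : EuclideanSpace ℝ ι => Real.exp (-(Q y / 2))) := by
  refine (Literature.Analysis.Asymptotics.integrable_exp_neg_mul_norm_sq (V := EuclideanSpace ℝ ι) (c := lam / 2) (by positivity)).mono
    (Real.measurable_exp.comp (hQm.div_const 2).neg).aestronglyMeasurable (Filter.Eventually.of_forall fun y => ?_)
  rw [Real.norm_eq_abs, Real.norm_eq_abs, abs_of_pos (Real.exp_pos _), abs_of_pos (Real.exp_pos _), Real.exp_le_exp]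
  have h1 := mul_norm_sq_le_diag hκlam y
  have h2 := hQ y
  linarith

/-- ★★ **THE DIAGONAL GAUSSIAN CEILING**: `Q` measurable, `Σ_i κ_i y_i² ≤ Q(y)` with `0 < λ ≤ κ_i` ⟹ `∫ e^{−Q/2} ≤ Π_i (2π/κ_i)^{1/2}`.
[cite: Breitung1994, Lemma 26 (2.102), p. 30] -/
theorem integral_exp_neg_half_le_of_diag {Q : EuclideanSpace ℝ ι → ℝ} (hQm : Measurable Q) {κ : ι → ℝ} {lam : ℝ} (hlam : 0 < lam)
    (hκlam : ∀ i, lam ≤ κ i) (hQ : ∀ y, ∑ i, κ i * (y i) ^ 2 ≤ Q y) :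
    ∫ y : EuclideanSpace ℝ ι, Real.exp (-(Q y / 2)) ≤ ∏ i, (2 * π / κ i) ^ (1 / 2 : ℝ) := by
  have hκ : ∀ i, 0 < κ i := fun i => lt_of_lt_of_le hlam (hκlam i)
  -- the diagonal Gaussian itself is integrable (same domination)
  have hDm : Measurable fun y : EuclideanSpace ℝ ι => ∑ i, κ i * (y i) ^ 2 := by
    refine Finset.measurable_sum _ fun i _ => ?_
    exact measurable_const.mul ((measurable_pi_apply i |>.comp (WithLp.measurable_ofLp 2 (ι → ℝ))).pow_const 2)
  have hDint := integrable_exp_neg_half_of_diag_le (Q := fun y => ∑ i, κ i * (y i) ^ 2) hDm hlam hκlam (fun y => le_rfl)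
  rw [← integral_exp_neg_half_diag κ hκ]
  refine integral_mono (integrable_exp_neg_half_of_diag_le hQm hlam hκlam hQ) ?_ fun y => ?_
  · refine hDint.congr (Filter.Eventually.of_forall fun y => ?_)
    show Real.exp (-((∑ i, κ i * (y i) ^ 2) / 2)) = Real.exp (-(1 / 2) * ∑ i, κ i * (y i) ^ 2)
    congr 1; ring
  · dsimp only
    rw [Real.exp_le_exp]
    have := hQ y
    linarith

/-- ★ **Normalised form**: `(2π)^{−|ι|/2}·∫ e^{−Q/2} ≤ Π_i κ_i^{−1/2}` — the fibre factor of a Morse–Bott density against its soft-mode stiffnesses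
(`finrank ℝ (EuclideanSpace ℝ ι) = |ι|`). [cite: Breitung1994, Lemma 26 (2.102), p. 30] -/
theorem normalised_integral_exp_neg_half_le_of_diag {Q : EuclideanSpace ℝ ι → ℝ} (hQm : Measurable Q) {κ : ι → ℝ} {lam : ℝ} (hlam : 0 < lam)
    (hκlam : ∀ i, lam ≤ κ i) (hQ : ∀ y, ∑ i, κ i * (y i) ^ 2 ≤ Q y) :
    ((2 * π) ^ ((finrank ℝ (EuclideanSpace ℝ ι) : ℝ) / 2))⁻¹ * ∫ y : EuclideanSpace ℝ ι, Real.exp (-(Q y / 2)) ≤ ∏ i, (κ i) ^ (-(1 / 2 : ℝ)) := by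
  have hκ : ∀ i, 0 < κ i := fun i => lt_of_lt_of_le hlam (hκlam i)
  have h2π : (0 : ℝ) < 2 * π := by positivity
  have hpow : (0 : ℝ) < (2 * π) ^ ((finrank ℝ (EuclideanSpace ℝ ι) : ℝ) / 2) := Real.rpow_pos_of_pos h2π _
  have h := integral_exp_neg_half_le_of_diag hQm hlam hκlam hQ
  -- `Π (2π/κ_i)^{1/2} = (2π)^{|ι|/2} · Π κ_i^{−1/2}`
  have hsplit : ∏ i, (2 * π / κ i) ^ (1 / 2 : ℝ) = (2 * π) ^ ((finrank ℝ (EuclideanSpace ℝ ι) : ℝ) / 2) * ∏ i, (κ i) ^ (-(1 / 2 : ℝ)) := by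
    rw [finrank_euclideanSpace]
    have hi : ∀ i, (2 * π / κ i) ^ (1 / 2 : ℝ) = (2 * π) ^ (1 / 2 : ℝ) * (κ i) ^ (-(1 / 2 : ℝ)) := fun i => by
      rw [Real.div_rpow h2π.le (hκ i).le, Real.rpow_neg (hκ i).le, div_eq_mul_inv]
    rw [Finset.prod_congr rfl fun i _ => hi i, Finset.prod_mul_distrib, Finset.prod_const, Finset.card_univ, ← Real.rpow_natCast,
      ← Real.rpow_mul h2π.le]
    congr 2
    ring
  rw [hsplit] at h
  rw [inv_mul_le_iff₀ hpow]
  exact h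

end Summit.QuantumFields.YangMills.Theorems.QuantitativeLaplace

end
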